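import Mathlib.Analysis.InnerProductSpace.PiL2
import Mathlib.Analysis.Matrix.Spectrum
import Mathlib.Analysis.Matrix.PosDef
import Mathlib.Analysis.SpecialFunctions.Integrals.Basic
import Mathlib.MeasureTheory.Measure.WithDensity
import Literature.Analysis.FunctionSpaces.BochnerProofs
import HarnessLib

/-!
# Positive-definite sequences: Carathéodory–Toeplitz extension and Fejér approximants

Second file of the proof of `Literature.Analysis.InverseSpectral.KreinHelicalRepresentation`
(Arov–Dym 2012, Thm 9.1), containing the purely discrete ingredients, phrased with the tree's
`Literature.Analysis.FunctionSpaces.IsPositiveDefinite` on the group `ℤ`: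

* `isPositiveDefinite_inner_pow`: for a linear isometry `U` of a complex inner product space and a
  vector `v`, `k ↦ ⟪v, Uᵏ v⟫` (`k ≥ 0`, extended by Hermitian symmetry) is positive definite;
* `caratheodory_toeplitz` (**Carathéodory 1911 / Toeplitz 1911**): a positive semidefinite
  Toeplitz matrix `(a(j - i))_{i,j ≤ m}` is a section of a positive-definite sequence on `ℤ`.
  Proof: realise the matrix as a Gram matrix `⟪vᵢ, vⱼ⟫` (spectral theorem), extend the shift
  `vᵢ ↦ vᵢ₊₁` (an isometry on `span {v₀, …, v_{m-1}}` by the Toeplitz property) to an isometry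
  `U` of the whole finite-dimensional space (Mathlib's `LinearIsometry.extend`), and take
  `k ↦ ⟪v₀, Uᵏ v₀⟫`;
* `exists_fejer_measure` (**Fejér means / Herglotz approximants**): for a positive-definite
  sequence `D` and `M ≥ 1` the trigonometric polynomial
  `F_M(θ) = M⁻¹ ∑_{p,q<M} D(q-p) e^{i(q-p)θ}` is nonnegative, and the measure
  `ν = F_M dθ/2π` on `(-π, π]` has `∫ e^{-ijθ} dν = (1 - |j|/M) D(j)` for `|j| < M`;
* second differences and the telescoping identity
  `c_k = c_0 + k (c_1 - c_0) - ∑_{0<j<k} (k - j) d_j`, `d_j = 2c_j - c_{j+1} - c_{j-1}`, together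
  with the closed form `(2 - 2cos θ) ∑_{0<j<k} (k-j) e^{-ijθ} = -(e^{-ikθ} - 1 - k(e^{-iθ} - 1))`.

## References

* C. Carathéodory, Rend. Circ. Mat. Palermo 32 (1911) 193–217; O. Toeplitz, ibid. 191–192
  (the Carathéodory–Toeplitz extension theorem).
* L. Fejér, J. reine angew. Math. 146 (1916) 53–82; G. Herglotz, Leipz. Ber. 63 (1911) 501–511.
* D. Z. Arov, H. Dym, *Bitangential direct and inverse problems…*, CUP 2012, Thm 9.1 (where these
  results are used, via discretisation, in this formalisation).
-/

open MeasureTheory Set Complex Filter Finset Literature.Analysis.FunctionSpaces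
open scoped ComplexConjugate ENNReal NNReal Topology BigOperators InnerProductSpace ComplexOrder Matrix

noncomputable section

namespace Literature.Analysis.InverseSpectral

/-! ### Positive-definite sequences on `ℤ` -/

/-- Reflecting a positive-definite function keeps it positive definite: the form of `D ∘ neg`
with coefficients `c` is the form of `D` with coefficients `conj c`. [folklore] -/
theorem isPositiveDefinite_comp_neg {G : Type*} [AddCommGroup G] {D : G → ℂ}
    (hD : IsPositiveDefinite D) : IsPositiveDefinite fun x => D (-x) := by
  intro n x c
  have h := hD n x (fun i => conj (c i))
  have heq : (∑ i, ∑ j, conj (c i) * c j * D (-(x j - x i))) =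
      ∑ i, ∑ j, conj (conj (c i)) * conj (c j) * D (x j - x i) := by
    rw [Finset.sum_comm]
    refine Finset.sum_congr rfl fun i _ => Finset.sum_congr rfl fun j _ => ?_
    rw [Complex.conj_conj, neg_sub]
    ring
  rw [heq]
  exact h

/-- The positive-definite sequence attached to an isometry `U` and a vector `v`:
`k ↦ ⟪v, Uᵏ v⟫` for `k ≥ 0` and `k ↦ conj ⟪v, U⁻ᵏ v⟫` for `k < 0`. [folklore] -/
theorem isPositiveDefinite_inner_pow {E : Type*} [NormedAddCommGroup E] [InnerProductSpace ℂ E]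
    (U : E →ₗᵢ[ℂ] E) (v : E) :
    IsPositiveDefinite fun k : ℤ =>
      if 0 ≤ k then ⟪v, (U ^ k.toNat) v⟫_ℂ else conj ⟪v, (U ^ (-k).toNat) v⟫_ℂ := by
  intro n x c
  -- shift the configuration into `ℕ`
  set N : ℕ := ∑ i, (x i).natAbs with hN
  have hxN : ∀ i, 0 ≤ x i + N := by
    intro i
    have h1 : |x i| ≤ N := by
      rw [hN]; push_cast
      exact Finset.single_le_sum (f := fun j => |x j|) (fun j _ => abs_nonneg _) (Finset.mem_univ i)
    have h2 : -x i ≤ |x i| := neg_le_abs _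
    linarith
  set p : Fin n → ℕ := fun i => (x i + N).toNat with hp
  have hpx : ∀ i, (p i : ℤ) = x i + N := fun i => Int.toNat_of_nonneg (hxN i)
  set w : Fin n → E := fun i => (U ^ p i) v with hw
  -- the key identity `D (x j - x i) = ⟪w i, w j⟫`
  have hpos : ∀ i j, p i ≤ p j →
      (if 0 ≤ x j - x i then ⟪v, (U ^ (x j - x i).toNat) v⟫_ℂ
        else conj ⟪v, (U ^ (-(x j - x i)).toNat) v⟫_ℂ) = ⟪w i, w j⟫_ℂ := by
    intro i j hij
    have hdiff : x j - x i = ((p j - p i : ℕ) : ℤ) := by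
      rw [Nat.cast_sub hij, hpx, hpx]; ring
    have hnn : 0 ≤ x j - x i := by rw [hdiff]; positivity
    rw [if_pos hnn, hdiff, Int.toNat_natCast, hw]
    dsimp only
    conv_rhs => rw [← Nat.add_sub_cancel' hij, pow_add, LinearIsometry.coe_mul,
      Function.comp_apply, LinearIsometry.inner_map_map]
  have hD : ∀ i j, (if 0 ≤ x j - x i then ⟪v, (U ^ (x j - x i).toNat) v⟫_ℂ
        else conj ⟪v, (U ^ (-(x j - x i)).toNat) v⟫_ℂ) = ⟪w i, w j⟫_ℂ := by
    intro i j
    rcases le_total (p i) (p j) with hij | hij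
    · exact hpos i j hij
    · rcases (hij.lt_or_eq) with hlt | heq
      · have hneg : ¬ (0 ≤ x j - x i) := by
          have : (p j : ℤ) < p i := by exact_mod_cast hlt
          rw [hpx, hpx] at this
          linarith
        have h := hpos j i hij
        rw [if_pos (by have : (p j : ℤ) ≤ p i := by exact_mod_cast hij
                       rw [hpx, hpx] at this; linarith)] at h
        rw [if_neg hneg, neg_sub, h, inner_conj_symm]
      · exact hpos i j heq.ge
  simp_rw [hD]
  have hsum : (∑ i, ∑ j, conj (c i) * c j * ⟪w i, w j⟫_ℂ) = ⟪∑ i, c i • w i, ∑ j, c j • w j⟫_ℂ := by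
    rw [sum_inner]
    refine Finset.sum_congr rfl fun i _ => ?_
    rw [inner_sum]
    refine Finset.sum_congr rfl fun j _ => ?_
    rw [inner_smul_left, inner_smul_right]
    ring
  rw [hsum]
  refine ⟨?_, ?_⟩
  · have := inner_self_nonneg (𝕜 := ℂ) (x := ∑ i, c i • w i)
    simpa using this
  · have := inner_self_im (𝕜 := ℂ) (∑ i, c i • w i)
    simpa using this

/-! ### The Carathéodory–Toeplitz extension theorem -/

/-- A positive semidefinite complex matrix is a Gram matrix `Bᴴ B` (spectral theorem).
[folklore] -/
theorem exists_conjTranspose_mul_self_eq {n : Type*} [Fintype n] [DecidableEq n]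
    {P : Matrix n n ℂ} (hP : P.PosSemidef) : ∃ B : Matrix n n ℂ, Bᴴ * B = P := by
  have hdd : (fun i => ((Real.sqrt (hP.1.eigenvalues i) : ℝ) : ℂ) *
      (Real.sqrt (hP.1.eigenvalues i) : ℝ)) = RCLike.ofReal ∘ hP.1.eigenvalues :=
      funext fun i => by
    rw [← Complex.ofReal_mul, Real.mul_self_sqrt (hP.eigenvalues_nonneg i)]
    rfl
  have hdstar : star (fun i => ((Real.sqrt (hP.1.eigenvalues i) : ℝ) : ℂ)) =
      fun i => ((Real.sqrt (hP.1.eigenvalues i) : ℝ) : ℂ) := funext fun i => by simp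
  refine ⟨Matrix.diagonal (fun i => ((Real.sqrt (hP.1.eigenvalues i) : ℝ) : ℂ)) *
      star (hP.1.eigenvectorUnitary : Matrix n n ℂ), ?_⟩
  conv_rhs => rw [hP.1.spectral_theorem, Unitary.conjStarAlgAut_apply]
  rw [Matrix.conjTranspose_mul, Matrix.diagonal_conjTranspose, hdstar,
    ← Matrix.star_eq_conjTranspose, star_star, Matrix.mul_assoc,
    ← Matrix.mul_assoc (Matrix.diagonal _), Matrix.diagonal_mul_diagonal, ← Matrix.mul_assoc, hdd]

/-- Gram vectors in Euclidean space realising a positive semidefinite matrix: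
`⟪vᵢ, vⱼ⟫ = P i j`. [folklore] -/
theorem exists_gram_vectors {n : Type*} [Fintype n] [DecidableEq n] {P : Matrix n n ℂ}
    (hP : P.PosSemidef) :
    ∃ v : n → EuclideanSpace ℂ n, ∀ i j, ⟪v i, v j⟫_ℂ = P i j := by
  obtain ⟨B, hB⟩ := exists_conjTranspose_mul_self_eq hP
  refine ⟨fun i => WithLp.toLp 2 fun k => B k i, fun i j => ?_⟩
  rw [← hB, Matrix.mul_apply, PiLp.inner_apply]
  refine Finset.sum_congr rfl fun k _ => ?_
  simp [Matrix.conjTranspose_apply, mul_comm]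

/-- **Carathéodory–Toeplitz extension theorem.** If the Toeplitz matrix `(a(j - i))_{i,j ≤ m}`
is positive semidefinite, then there is a positive-definite sequence `D` on `ℤ` with
`D(k) = a(k)` for `|k| ≤ m`. Proof by isometric extension of the shift on Gram vectors
(`LinearIsometry.extend`), `D(k) = ⟪v₀, Uᵏ v₀⟫`. [folklore] -/
theorem caratheodory_toeplitz {m : ℕ} (a : ℤ → ℂ)
    (hA : (Matrix.of fun i j : Fin (m + 1) => a ((j : ℤ) - i)).PosSemidef) :
    ∃ D : ℤ → ℂ, IsPositiveDefinite D ∧ ∀ k : ℤ, |k| ≤ m → D k = a k := by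
  classical
  obtain ⟨v, hv⟩ := exists_gram_vectors hA
  simp only [Matrix.of_apply] at hv
  -- the Toeplitz property as shift invariance of the Gram matrix
  have hshift : ∀ i j : Fin m, ⟪v i.succ, v j.succ⟫_ℂ = ⟪v i.castSucc, v j.castSucc⟫_ℂ := by
    intro i j
    rw [hv, hv]
    congr 1
    simp only [Fin.val_succ, Fin.val_castSucc]
    push_cast
    ring
  -- the two parametrisations of `span {v₀,…,v_{m-1}}` and of its shift
  set Φ : (Fin m → ℂ) →ₗ[ℂ] EuclideanSpace ℂ (Fin (m + 1)) :=
    Fintype.linearCombination ℂ (fun i : Fin m => v i.castSucc) with hΦ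
  set Ψ : (Fin m → ℂ) →ₗ[ℂ] EuclideanSpace ℂ (Fin (m + 1)) :=
    Fintype.linearCombination ℂ (fun i : Fin m => v i.succ) with hΨ
  have hinner : ∀ b b' : Fin m → ℂ, ⟪Φ b, Φ b'⟫_ℂ = ⟪Ψ b, Ψ b'⟫_ℂ := by
    intro b b'
    simp only [hΦ, hΨ, Fintype.linearCombination_apply, sum_inner, inner_sum, inner_smul_left,
      inner_smul_right, hshift]
  have hnorm : ∀ b : Fin m → ℂ, ‖Ψ b‖ = ‖Φ b‖ := by
    intro b
    have h := hinner b b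
    rw [inner_self_eq_norm_sq_to_K, inner_self_eq_norm_sq_to_K] at h
    have h' : ‖Φ b‖ ^ 2 = ‖Ψ b‖ ^ 2 := by exact_mod_cast h
    exact ((sq_eq_sq₀ (norm_nonneg _) (norm_nonneg _)).1 h').symm
  have hker : ∀ b : Fin m → ℂ, Φ b = 0 → Ψ b = 0 := by
    intro b hb
    rw [← norm_eq_zero, hnorm, hb, norm_zero]
  -- a linear right inverse of `Φ` onto its range
  obtain ⟨g, hg⟩ := LinearMap.exists_rightInverse_of_surjective Φ.rangeRestrict
    Φ.range_rangeRestrict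
  have hgΦ : ∀ y : LinearMap.range Φ, Φ (g y) = y := by
    intro y
    have := LinearMap.congr_fun hg y
    simpa using congrArg Subtype.val this
  have hL₀ : ∀ (y : LinearMap.range Φ) (b : Fin m → ℂ), Φ b = y → Ψ (g y) = Ψ b := by
    intro y b hb
    have h0 : Φ (g y - b) = 0 := by rw [map_sub, hgΦ, hb, sub_self]
    have := hker _ h0
    rwa [map_sub, sub_eq_zero] at this
  -- the shift as a linear isometry on `range Φ`
  let L : LinearMap.range Φ →ₗᵢ[ℂ] EuclideanSpace ℂ (Fin (m + 1)) :=
    { toLinearMap := Ψ.comp g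
      norm_map' := by
        intro y
        obtain ⟨b, hb⟩ := LinearMap.mem_range.1 y.2
        simp only [LinearMap.coe_comp, Function.comp_apply]
        rw [hL₀ y b hb, hnorm, hb, Submodule.coe_norm] }
  have hLapply : ∀ i : Fin m, L ⟨v i.castSucc, ⟨Pi.single i 1, by simp [hΦ]⟩⟩ = v i.succ := by
    intro i
    change Ψ (g _) = _
    rw [hL₀ _ (Pi.single i 1) (by simp [hΦ])]
    simp [hΨ]
  -- extend to an isometry of the whole space
  set U := L.extend with hU
  have hUv : ∀ i : Fin m, U (v i.castSucc) = v i.succ := by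
    intro i
    rw [← hLapply i, hU]
    exact L.extend_apply ⟨v i.castSucc, ⟨Pi.single i 1, by simp [hΦ]⟩⟩
  have hpow : ∀ k : ℕ, ∀ hk : k < m + 1, (U ^ k) (v 0) = v ⟨k, hk⟩ := by
    intro k
    induction k with
    | zero => intro hk; simp
    | succ k ih =>
      intro hk
      have hk' : k < m := by omega
      rw [pow_succ', LinearIsometry.coe_mul, Function.comp_apply, ih (by omega)]
      have h1 : (⟨k, by omega⟩ : Fin (m + 1)) = (⟨k, hk'⟩ : Fin m).castSucc := rfl
      have h2 : (⟨k + 1, hk⟩ : Fin (m + 1)) = (⟨k, hk'⟩ : Fin m).succ := rfl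
      rw [h1, hUv, h2]
  -- the extension
  refine ⟨fun k : ℤ => if 0 ≤ k then ⟪v 0, (U ^ k.toNat) (v 0)⟫_ℂ
      else conj ⟪v 0, (U ^ (-k).toNat) (v 0)⟫_ℂ, isPositiveDefinite_inner_pow U (v 0), ?_⟩
  intro k hk
  have habs := abs_le.1 hk
  dsimp only
  by_cases h0 : 0 ≤ k
  · rw [if_pos h0, hpow k.toNat (by omega), hv]
    congr 1
    simp only [Fin.val_zero, Nat.cast_zero, sub_zero]
    exact Int.toNat_of_nonneg h0
  · rw [if_neg h0, hpow (-k).toNat (by omega), hv]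
    have hherm := hA.1.apply ⟨(-k).toNat, by omega⟩ 0
    simp only [Matrix.of_apply, Fin.val_zero, Nat.cast_zero, sub_zero, zero_sub] at hherm ⊢
    rw [Int.toNat_of_nonneg (by omega : 0 ≤ -k), neg_neg] at hherm
    rw [Int.toNat_of_nonneg (by omega : 0 ≤ -k), ← hherm]
    simp

/-! ### Fejér approximants of a positive-definite sequence -/

/-- `∫_{(-π, π]} e^{inθ} dθ = 2π` if `n = 0` and `0` otherwise (`n ∈ ℤ`). [folklore] -/
theorem setIntegral_cexp_int_mul (n : ℤ) :
    ∫ θ in Set.Ioc (-Real.pi) Real.pi, cexp (I * n * θ) =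
      if n = 0 then (2 * Real.pi : ℂ) else 0 := by
  rw [← intervalIntegral.integral_of_le (by linarith [Real.pi_pos] : -Real.pi ≤ Real.pi)]
  split_ifs with hn
  · subst hn
    simp only [Int.cast_zero, mul_zero, zero_mul, Complex.exp_zero]
    rw [intervalIntegral.integral_const]
    simp only [sub_neg_eq_add, Complex.real_smul, mul_one]
    push_cast; ring
  · have hc : (I * n : ℂ) ≠ 0 := mul_ne_zero Complex.I_ne_zero (by exact_mod_cast hn)
    rw [integral_exp_mul_complex hc]
    have hper : cexp (I * n * (Real.pi : ℝ)) = cexp (I * n * (-Real.pi : ℝ)) := by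
      have h2 : I * n * (Real.pi : ℝ) = I * n * (-Real.pi : ℝ) + n * (2 * Real.pi * I) := by
        push_cast; ring
      rw [h2, Complex.exp_add, Complex.exp_int_mul_two_pi_mul_I, mul_one]
    rw [hper, sub_self, zero_div]

/-- Counting lemma: `∑_{q<M} [q = z] = [0 ≤ z < M]` for an integer `z`. [folklore] -/
lemma sum_ite_natCast_eq (M : ℕ) (z : ℤ) :
    (∑ q ∈ Finset.range M, if (q : ℤ) = z then (1 : ℂ) else 0) =
      if 0 ≤ z ∧ z < M then 1 else 0 := by
  by_cases hz : 0 ≤ z ∧ z < M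
  · rw [if_pos hz]
    rw [Finset.sum_eq_single z.toNat]
    · rw [if_pos (Int.toNat_of_nonneg hz.1)]
    · intro q _ hne
      rw [if_neg]
      omega
    · intro h
      exfalso
      apply h
      rw [Finset.mem_range]
      omega
  · rw [if_neg hz]
    refine Finset.sum_eq_zero fun q hq => ?_
    rw [Finset.mem_range] at hq
    rw [if_neg]
    omega

/-- Counting lemma: the number of pairs `p, q < M` with `q - p = j` is `M - |j|` when
`|j| ≤ M`. [folklore] -/
lemma sum_sum_ite_sub_eq (M : ℕ) (j : ℤ) (hj : j.natAbs ≤ M) :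
    (∑ p ∈ Finset.range M, ∑ q ∈ Finset.range M, if (q : ℤ) - p = j then (1 : ℂ) else 0) =
      ((M - j.natAbs : ℕ) : ℂ) := by
  have h1 : ∀ p ∈ Finset.range M,
      (∑ q ∈ Finset.range M, if (q : ℤ) - p = j then (1 : ℂ) else 0) =
        if 0 ≤ (p : ℤ) + j ∧ (p : ℤ) + j < M then 1 else 0 := by
    intro p _
    rw [← sum_ite_natCast_eq M ((p : ℤ) + j)]
    refine Finset.sum_congr rfl fun q _ => ?_
    congr 1
    apply propext
    omega
  rw [Finset.sum_congr rfl h1, Finset.sum_boole]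
  congr 1
  rcases le_or_gt 0 j with hj0 | hj0
  · have : (Finset.range M).filter (fun p : ℕ => 0 ≤ (p : ℤ) + j ∧ (p : ℤ) + j < M) =
        Finset.range (M - j.natAbs) := by
      ext p
      simp only [Finset.mem_filter, Finset.mem_range]
      omega
    rw [this, Finset.card_range]
  · have : (Finset.range M).filter (fun p : ℕ => 0 ≤ (p : ℤ) + j ∧ (p : ℤ) + j < M) =
        Finset.Ico j.natAbs M := by
      ext p
      simp only [Finset.mem_filter, Finset.mem_range, Finset.mem_Ico]
      omega
    rw [this, Nat.card_Ico]

/-- The Fejér trigonometric polynomial of a positive-definite sequence,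
`∑_{p,q<M} D(q-p) e^{i(q-p)θ}`, is a nonnegative real number (positive definiteness with
coefficients `e^{ipθ}`). [folklore] -/
lemma fejer_sum_nonneg {D : ℤ → ℂ} (hD : IsPositiveDefinite D) (M : ℕ) (θ : ℝ) :
    0 ≤ (∑ p ∈ Finset.range M, ∑ q ∈ Finset.range M,
        D ((q : ℤ) - p) * cexp (I * (((q : ℤ) - p : ℤ) : ℂ) * θ)).re ∧
      (∑ p ∈ Finset.range M, ∑ q ∈ Finset.range M,
        D ((q : ℤ) - p) * cexp (I * (((q : ℤ) - p : ℤ) : ℂ) * θ)).im = 0 := by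
  have h := hD M (fun p => ((p : ℕ) : ℤ)) (fun p => cexp (I * ((p : ℕ) : ℂ) * θ))
  have heq : (∑ i : Fin M, ∑ j : Fin M, conj (cexp (I * ((i : ℕ) : ℂ) * θ)) *
      cexp (I * ((j : ℕ) : ℂ) * θ) * D (((j : ℕ) : ℤ) - ((i : ℕ) : ℤ))) =
      ∑ p ∈ Finset.range M, ∑ q ∈ Finset.range M,
        D ((q : ℤ) - p) * cexp (I * (((q : ℤ) - p : ℤ) : ℂ) * θ) := by
    rw [Finset.sum_range (fun p => ∑ q ∈ Finset.range M,
        D ((q : ℤ) - p) * cexp (I * (((q : ℤ) - p : ℤ) : ℂ) * θ))]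
    refine Finset.sum_congr rfl fun p _ => ?_
    rw [Finset.sum_range (fun q => D ((q : ℤ) - p) * cexp (I * (((q : ℤ) - p : ℤ) : ℂ) * θ))]
    refine Finset.sum_congr rfl fun q _ => ?_
    rw [← Complex.exp_conj, map_mul, map_mul, Complex.conj_I, Complex.conj_ofReal,
      Complex.conj_natCast, mul_comm _ (D _), mul_assoc, ← Complex.exp_add]
    congr 2
    push_cast
    ring
  rw [heq] at h
  exact h

/-- **Fejér approximants.** For a positive-definite sequence `D` on `ℤ` and `M ≥ 1` there is a
finite measure `ν` on `ℝ`, absolutely continuous and carried by `(-π, π]`, of total mass `D 0`,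
whose Fourier coefficients are `∫ e^{-ijθ} dν = (1 - |j|/M) D(j)` for `|j| ≤ M`: the measure
with density `(2πM)⁻¹ ∑_{p,q<M} D(q-p) e^{i(q-p)θ} ≥ 0` (Fejér means of the formal Fourier
series of `D`; these are the approximants in Herglotz's theorem). [folklore] -/
theorem exists_fejer_measure {D : ℤ → ℂ} (hD : IsPositiveDefinite D) {M : ℕ} (hM : 0 < M) :
    ∃ ν : Measure ℝ, IsFiniteMeasure ν ∧ ν ≪ volume ∧ ν (Set.Ioc (-Real.pi) Real.pi)ᶜ = 0 ∧
      ∀ j : ℤ, j.natAbs ≤ M →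
        ∫ θ, cexp (-(I * j * θ)) ∂ν = ((M - j.natAbs : ℕ) : ℂ) / M * D j := by
  -- the Fejér polynomial and its basic properties
  set S : ℝ → ℂ := fun θ => ∑ p ∈ Finset.range M, ∑ q ∈ Finset.range M,
    D ((q : ℤ) - p) * cexp (I * (((q : ℤ) - p : ℤ) : ℂ) * θ) with hS
  have hSnn : ∀ θ, 0 ≤ (S θ).re ∧ (S θ).im = 0 := fun θ => fejer_sum_nonneg hD M θ
  have hSre : ∀ θ, ((S θ).re : ℂ) = S θ := fun θ =>
    Complex.ext (by simp) (by simp [(hSnn θ).2])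
  have hScont : Continuous S := by
    simp only [hS]
    fun_prop
  have hD0 : ∀ k, ‖D k‖ ≤ (D 0).re := fun k => IsPositiveDefinite.norm_apply_le_holds hD k
  have hSbd : ∀ θ, (S θ).re ≤ M * M * (D 0).re := by
    intro θ
    refine (Complex.re_le_norm _).trans ?_
    refine (norm_sum_le _ _).trans ?_
    have : ∀ p ∈ Finset.range M, ‖∑ q ∈ Finset.range M,
        D ((q : ℤ) - p) * cexp (I * (((q : ℤ) - p : ℤ) : ℂ) * θ)‖ ≤ M * (D 0).re := by
      intro p _
      refine (norm_sum_le _ _).trans ?_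
      have : ∀ q ∈ Finset.range M,
          ‖D ((q : ℤ) - p) * cexp (I * (((q : ℤ) - p : ℤ) : ℂ) * θ)‖ ≤ (D 0).re := by
        intro q _
        rw [norm_mul]
        have he : ‖cexp (I * (((q : ℤ) - p : ℤ) : ℂ) * θ)‖ = 1 := by
          have : I * (((q : ℤ) - p : ℤ) : ℂ) * θ = ((((q : ℤ) - p : ℤ) * θ : ℝ) : ℂ) * I := by
            push_cast; ring
          rw [this, Complex.norm_exp_ofReal_mul_I]
        rw [he, mul_one]
        exact hD0 _
      refine (Finset.sum_le_sum this).trans ?_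
      simp
    refine (Finset.sum_le_sum this).trans ?_
    simp [mul_assoc]
  -- the density and the measure
  set f : ℝ → ℝ≥0 := fun θ => ((S θ).re / (2 * Real.pi * M)).toNNReal with hf
  have hfm : Measurable f := by
    simp only [hf]
    exact (Complex.continuous_re.comp hScont).measurable.div_const _ |>.real_toNNReal
  have hfcoe : ∀ θ, (f θ : ℝ) = (S θ).re / (2 * Real.pi * M) := fun θ =>
    Real.coe_toNNReal _ (div_nonneg (hSnn θ).1 (by positivity))
  haveI : IsFiniteMeasure (volume.restrict (Set.Ioc (-Real.pi) Real.pi) : Measure ℝ) :=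
    ⟨by simp [Real.volume_Ioc]⟩
  set ν : Measure ℝ := (volume.restrict (Set.Ioc (-Real.pi) Real.pi)).withDensity
    (fun θ => (f θ : ℝ≥0∞)) with hν
  have hfbd : ∀ θ, (f θ : ℝ≥0∞) ≤ ENNReal.ofReal (M * M * (D 0).re / (2 * Real.pi * M)) := by
    intro θ
    rw [ENNReal.coe_nnreal_eq, hfcoe]
    refine ENNReal.ofReal_le_ofReal (div_le_div_of_nonneg_right (hSbd θ) (by positivity))
  haveI hνfin : IsFiniteMeasure ν := by
    refine isFiniteMeasure_withDensity (ne_of_lt ?_)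
    calc ∫⁻ θ, (f θ : ℝ≥0∞) ∂(volume.restrict (Set.Ioc (-Real.pi) Real.pi))
        ≤ ∫⁻ _θ, ENNReal.ofReal (M * M * (D 0).re / (2 * Real.pi * M))
          ∂(volume.restrict (Set.Ioc (-Real.pi) Real.pi)) :=
          lintegral_mono fun θ => hfbd θ
      _ < ⊤ := by
          rw [lintegral_const]
          exact ENNReal.mul_lt_top ENNReal.ofReal_lt_top (measure_lt_top _ _)
  -- integrals against `ν`
  have hint : ∀ g : ℝ → ℂ, Continuous g →
      ∫ θ, g θ ∂ν = ∫ θ in Set.Ioc (-Real.pi) Real.pi, (((S θ).re / (2 * Real.pi * M) : ℝ) : ℂ) * g θ := by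
    intro g hg
    rw [hν, integral_withDensity_eq_integral_smul hfm]
    refine integral_congr_ae (ae_of_all _ fun θ => ?_)
    dsimp only
    rw [NNReal.smul_def, hfcoe, Complex.real_smul]
  refine ⟨ν, hνfin, ?_, ?_, ?_⟩
  · exact (withDensity_absolutelyContinuous _ _).trans Measure.restrict_le_self.absolutelyContinuous
  · rw [hν, withDensity_apply _ measurableSet_Ioc.compl,
      Measure.restrict_restrict measurableSet_Ioc.compl, Set.compl_inter_self,
      Measure.restrict_empty, lintegral_zero_measure]
  · intro j hj
    rw [hint _ (by fun_prop)]
    -- expand the Fejér sum and integrate term by term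
    have hterm : ∀ θ : ℝ, (((S θ).re / (2 * Real.pi * M) : ℝ) : ℂ) * cexp (-(I * j * θ)) =
        (1 / (2 * Real.pi * M) : ℂ) * ∑ p ∈ Finset.range M, ∑ q ∈ Finset.range M,
          D ((q : ℤ) - p) * cexp (I * (((q : ℤ) - p - j : ℤ) : ℂ) * θ) := by
      intro θ
      rw [Complex.ofReal_div, hSre, div_eq_mul_inv, mul_comm (S θ), mul_assoc, hS]
      simp only [Finset.sum_mul]
      congr 1
      · push_cast; ring
      · refine Finset.sum_congr rfl fun p _ => Finset.sum_congr rfl fun q _ => ?_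
        rw [mul_assoc, ← Complex.exp_add]
        congr 2
        push_cast; ring
    simp_rw [hterm]
    rw [integral_const_mul]
    have hint1 : ∀ p q : ℕ, Integrable (fun θ : ℝ => D ((q : ℤ) - p) *
        cexp (I * (((q : ℤ) - p - j : ℤ) : ℂ) * θ)) (volume.restrict (Set.Ioc (-Real.pi) Real.pi)) := by
      intro p q
      exact ((by fun_prop : Continuous fun θ : ℝ => D ((q : ℤ) - p) *
        cexp (I * (((q : ℤ) - p - j : ℤ) : ℂ) * θ)).intervalIntegrable (-Real.pi) Real.pi).1
    rw [integral_finsetSum _ fun p _ => integrable_finsetSum _ fun q _ => hint1 p q]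
    simp_rw [integral_finsetSum _ fun q _ => hint1 _ q, integral_const_mul,
      setIntegral_cexp_int_mul]
    have hsel : ∀ p q : ℕ, D ((q : ℤ) - p) * (if ((q : ℤ) - p - j : ℤ) = 0 then (2 * Real.pi : ℂ) else 0)
        = (2 * Real.pi * D j) * (if (q : ℤ) - p = j then 1 else 0) := by
      intro p q
      by_cases h : (q : ℤ) - p = j
      · rw [if_pos h, if_pos (by omega), h]; ring
      · rw [if_neg h, if_neg (by omega)]; ring
    simp_rw [hsel, ← Finset.mul_sum]
    rw [sum_sum_ite_sub_eq M j hj]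
    have hπ : (Real.pi : ℂ) ≠ 0 := by exact_mod_cast Real.pi_ne_zero
    have hM' : (M : ℂ) ≠ 0 := by exact_mod_cast hM.ne'
    field_simp

/-! ### Second differences and telescoping -/

/-- **Telescoping identity** for second differences: with `d_i = 2c_i - c_{i+1} - c_{i-1}`,
`c_k = c_0 + k (c_0 - c_{-1}) - ∑_{i<k} (k - i) d_i` for every `k ∈ ℕ`. [folklore] -/
theorem eq_sub_sum_second_diff (c : ℤ → ℂ) (k : ℕ) :
    c k = c 0 + k * (c 0 - c (-1)) -
      ∑ i ∈ Finset.range k, ((k : ℂ) - i) * (2 * c i - c (i + 1) - c (i - 1)) := by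
  induction k using Nat.twoStepInduction with
  | zero => simp
  | one => simp; ring
  | more k ih1 ih2 =>
    have hlin : ∑ i ∈ Finset.range k, (((k + 2 : ℕ) : ℂ) - i) * (2 * c i - c (i + 1) - c (i - 1)) =
        2 * ∑ i ∈ Finset.range k, (((k + 1 : ℕ) : ℂ) - i) * (2 * c i - c (i + 1) - c (i - 1)) -
          ∑ i ∈ Finset.range k, ((k : ℂ) - i) * (2 * c i - c (i + 1) - c (i - 1)) := by
      rw [Finset.mul_sum, ← Finset.sum_sub_distrib]
      refine Finset.sum_congr rfl fun i _ => ?_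
      push_cast; ring
    rw [Finset.sum_range_succ, Finset.sum_range_succ, hlin]
    rw [Finset.sum_range_succ] at ih2
    have h1 : ((k + 2 : ℕ) : ℤ) = (k : ℤ) + 1 + 1 := by push_cast; ring
    have h2 : ((k + 1 : ℕ) : ℤ) = (k : ℤ) + 1 := by push_cast; ring
    rw [h2] at ih2
    rw [h1]
    push_cast at ih1 ih2 ⊢
    have hk1 : (k : ℤ) + 1 - 1 = k := by ring
    rw [hk1]
    linear_combination 2 * ih2 - ih1

/-- **Closed form of the summed geometric kernel**: for `z w` with `z w = 1`,
`(2 - z - w) ∑_{i<k} (k - i) zⁱ = 1 - zᵏ + k (1 - w)`. (Applied with `z = e^{-iθ}`,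
`w = e^{iθ}`, `2 - z - w = 2 - 2cos θ`.) [folklore] -/
theorem kernel_sum_closed_form (z w : ℂ) (hzw : z * w = 1) (k : ℕ) :
    (2 - z - w) * ∑ i ∈ Finset.range k, ((k : ℂ) - i) * z ^ i = 1 - z ^ k + k * (1 - w) := by
  induction k with
  | zero => simp
  | succ k ih =>
    have hsplit : ∑ i ∈ Finset.range (k + 1), (((k + 1 : ℕ) : ℂ) - i) * z ^ i =
        ∑ i ∈ Finset.range k, ((k : ℂ) - i) * z ^ i + ∑ i ∈ Finset.range (k + 1), z ^ i := by
      rw [Finset.sum_range_succ, Finset.sum_range_succ, ← add_assoc, ← Finset.sum_add_distrib]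
      congr 1
      · refine Finset.sum_congr rfl fun i _ => ?_
        push_cast; ring
      · push_cast; ring
    have hgeom : (∑ i ∈ Finset.range (k + 1), z ^ i) * (z - 1) = z ^ (k + 1) - 1 := geom_sum_mul z (k + 1)
    have hsucc : ∑ i ∈ Finset.range (k + 1), z ^ i = z * ∑ i ∈ Finset.range k, z ^ i + 1 :=
      geom_sum_succ
    have hgeom' : (∑ i ∈ Finset.range k, z ^ i) * (z - 1) = z ^ k - 1 := geom_sum_mul z k
    rw [hsplit, mul_add, ih]
    set G := ∑ i ∈ Finset.range (k + 1), z ^ i with hG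
    set G' := ∑ i ∈ Finset.range k, z ^ i with hG'
    push_cast
    linear_combination (-1 : ℂ) * hgeom + (1 - w) * hsucc - G' * hzw + hgeom'

end Literature.Analysis.InverseSpectral
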